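import Literature.MathematicalPhysics.QuantumLattice.HubbardTTPrimeCapCutDualRows
import Literature.MathematicalPhysics.QuantumLattice.HubbardOneBodyKinematicRows
import Literature.MathematicalPhysics.QuantumLattice.HubbardNNNHoppingEnergyDensityRegionBounds
import HarnessLib

/-!
# Transport of certified rows along the `t'` axis of the `t–t'–U` Hubbard model on `ℤ²`:
# a `t'`-BOX is covered by the words certified at its ENDPOINTS and at one ANCHOR

Family `hubbard` (topic `MathematicalPhysics/QuantumLattice`); companion of
`HubbardTTPrimeCapCutDualRows` (§6: the unit diagonal-hopping energy `K₂(ω) = e_{Φ(0,1,0)}(ω)` is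
ANTITONE in `t'` along cross-variational pairs), `HubbardTTPrimeMeanEnergySupergradient` (the
Hellmann–Feynman tangent inequality in the thermodynamic limit) and `HubbardOneBodyKinematicRows` (the
kinematic row `|K₂(ω)| ≤ 16/π²`). Written for the material-oracle front end (cell `hubbard-downfold`, stage
S1 ↦ S2): a downfolded material comes with a parameter BOX, here an interval `[s₁, s₂]` of next-nearest-
neighbour hoppings `t'` at fixed `(t, U, n)`, while certificates are solved at finitely many couplings.
This file proves what a certified word at the endpoints / at one anchor `s₀ ∈ [s₁, s₂]` says about EVERY
torus-limit ground state at EVERY `t'` of the box — the `t'`-direction robustness rows. Notation: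
`e(t,t',U,n) = energyDensityTT' t t' U n`; `e_Φ(ω) = ω.meanEnergy Φ 1`; `Φ(t,t',U) =
hubbardTTPrimeFermionInteraction t t' U`; `K₂(ω) = e_{Φ(0,1,0)}(ω)`; "torus-limit ground state at
`(t,s,U)`, density `n`" = torus limit `ω` along `Ls → ∞` of unit ground states of
`hubbardTorusTT' (Ls j) t s U` in the sectors `(rectN n (Ls j), S^z = 0)` (the hypothesis class of all
`t–t'` correlator / window certificates of the tree); a "ceiling word `A` at `s`" is the certified
statement `K₂(ω) ≤ A` for every such `ω` at `(t,s,U)`, a "floor word `B`" is `B ≤ K₂(ω)`.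

* §1 **The `K₂` word is monotone-transported.** A ceiling word `A` at `s₁` is a ceiling word at every
  `s ≥ s₁`; a floor word `B` at `s₂` is a floor word at every `s ≤ s₂`; hence the two ENDPOINT words of
  a box bracket `K₂` of every ground state of the box (`IsTorusLimitOf.meanEnergy_diagHop_le_of_forall_left`,
  `…le_meanEnergy_diagHop_of_forall_right`, `…meanEnergy_diagHop_mem_Icc_of_forall_endpoints`). Proof:
  antitonicity against a torus-limit ground state at the endpoint, which exists
  (`exists_isTorusLimitOf_squareGroundStatesTT'_meanEnergy_eq`).
* §2 the dilute kinematic row `|K₂(ω)| ≤ 4n` (`IsTorusLimitOf.abs_meanEnergy_diagHop_le_four_mul`, from the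
  tree's free diagonal band `energyDensityTT'_diag_free_ge`), better than `16/π²` for `n < 4/π²`.
* §5 **Energy increments inside the box from the endpoint words** — the "Lipschitz constant from
  certified hopping-correlator bounds": for `s₁ ≤ s ≤ s' ≤ s₂`,
  `B (s' − s) ≤ e(t,s',U,n) − e(t,s,U,n) ≤ A (s' − s)` (`energyDensityTT'_sub_le_mul_of_forall_diagHop_le`,
  `mul_le_energyDensityTT'_sub_of_forall_le_diagHop`, `energyDensityTT'_sub_mem_Icc_of_forall_endpoints`);
  hence `|e(s) − e(s')| ≤ max(|A|,|B|)·|s − s'|` on the box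
  (`abs_energyDensityTT'_sub_tPrime_le_of_forall_endpoints`), and a certified SIGN of the word fixes the
  monotonicity of `t' ↦ e` on a half-line (`monotoneOn_energyDensityTT'_tPrime_of_forall_diagHop_nonneg`,
  `antitoneOn_energyDensityTT'_tPrime_of_forall_diagHop_nonpos`). Word-free fallback with the kinematic
  constant: `|e(t,s,U,n) − e(t,s',U,n)| ≤ (16/π²)|s − s'|`
  (`abs_energyDensityTT'_sub_tPrime_le_sixteen_div_pi_sq`; sharper than the tree's `4n|s − s'|`,
  `abs_energyDensityTT'_sub_tPrime_le`, as soon as `n > 4/π²`).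
* §3 **Transport of the energy CAP (window inflation).** A ground state `ω` at `(t,s,U)` is, for the
  ANCHOR Hamiltonian at `(t,s₀,U)`, a state in the window
  `e(t,s₀,U,n) ≤ e_{Φ(t,s₀,U)}(ω) ≤ e(t,s₀,U,n) + (s − s₀)(K₂(ω₀) − K₂(ω))` for every ground state `ω₀` at
  the anchor (`IsTorusLimitOf.meanEnergy_anchor_le_of_groundStates`: affine identity + tangent inequality);
  with words: `≤ u₀ + (s − s₀)(A₀ − B₊)` right of the anchor, `≤ u₀ + (s₀ − s)(A₋ − B₀)` left of it, and
  `≤ u₀ + |s − s₀|(A₋ − B₊)` anywhere in the box from the two endpoint words alone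
  (`…meanEnergy_anchor_le_of_forall_right/left`, `…meanEnergy_anchor_mem_Icc_of_forall_endpoints`); word-free:
  `≤ e(t,s₀,U,n) + (32/π²)|s − s₀|` (`…meanEnergy_anchor_le_kinematic`). This is the row by which a
  certificate at the anchor whose hypotheses on the state are an energy cap plus state-independent rows
  (positivity, translation/point-group invariance, gauge invariance, kinematic rows — NOT the equations of
  motion of the anchor Hamiltonian) speaks about every ground state of the box:
* §4 **BOX ⇒ WORD**: if a property `P` holds for every torus limit of unit `rectN n`-vectors whose
  `Φ(t,s₀,U)`-energy is at most `u`, and `u ≥ u₀ + max(s₂ − s₀, s₀ − s₁)(A₋ − B₊)` (resp. `… · 32/π²`),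
  then `P` holds for every torus-limit ground state at every `t' ∈ [s₁, s₂]`
  (`forall_groundState_tPrime_box_of_forall_cap`, `…_of_forall_cap_kinematic`).
* §6 **The Lipschitz constant of a cap-class WORD along `t'` is `κ_cap·(A − B)`**: a real word certified
  at the anchor with its cap slack explicit, `c + κ(u₀ − e_{Φ(t,s₀,U)}(ω)) ≤ f ω` on the cap class,
  gives `c − κ|s − s₀|(A − B) ≤ f ω` for every ground state of the box
  (`IsTorusLimitOf.sub_mul_le_word_of_forall_capSlack`; word-free `…_kinematic` with `32/π²`); and the
  closed-box floor rule `min lo₁ lo₂ ≤ e(t,s,U,n)` on `[s₁, s₂]` (`energyDensityTT'_ge_min_of_mem_Icc_tPrime`).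
* §7 **Half filling** (`n = 1`, parent compounds): `e(t,·,U,1)` is even and concave, hence monotone on
  each side of `t' = 0` (`monotoneOn_energyDensityTT'_tPrime_one`, `antitoneOn_energyDensityTT'_tPrime_one`)
  — a box on one side of `0` is covered LOSS-FREE by one endpoint floor and the other endpoint cap
  (`energyDensityTT'_one_mem_Icc_of_box_nonpos/nonneg`); and the SIGN WORD IS FREE: `0 ≤ K₂(ω)` for
  every ground state at `t' < 0`, `K₂(ω) ≤ 0` at `t' > 0`
  (`IsTorusLimitOf.meanEnergy_diagHop_nonneg_of_one_of_neg`, `…_nonpos_of_one_of_pos`), so right of an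
  anchor on the negative axis the cap inflation is `(s − s₀)·A₀` from the anchor's ceiling word alone
  (`IsTorusLimitOf.meanEnergy_anchor_le_of_one_of_neg`).

What is deliberately NOT here: words proved for ground states AT the anchor only (e.g. from certificates
using the anchor's equation-of-motion rows) do not transport by §3–§4 — a ground state at `s ≠ s₀` is not
stationary for the anchor Hamiltonian; such words are covered box-wise by the cell kernels
(`HubbardTTPrimeWindowCertificateConvexComb`, `…CrossCuts`) from certificates at all box corners. The `U`
and density directions are other seats' files (`HubbardTTPrimeCapCutDualRows` §4, §8;
`HubbardEnergyDensityChordBounds`). HONEST FRAMING: certificate bookkeeping for the systematic → certified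
interface; no number is produced here and nothing here bears on superconductivity by itself.
Everything is PROVED; no definition, no named fact, no numerical input.

## Mathlib / tree search

REUSED: `IsTorusLimitOf.diagHopEnergy_anti_of_groundStates`, `InfVolFermionState.meanEnergy_hubbardTTPrime_affine`,
`…_smul` (`HubbardTTPrimeCapCutDualRows`, `HubbardTTPrimeMeanEnergySupergradient`);
`IsTorusLimitOf.energyDensityTT'_sub_le_mul_meanEnergy_diag`, `IsTorusLimitOf.meanEnergy_hubbardTTPrime_eq_energyDensityTT'`,
`IsTorusLimitOf.energyDensityTT'_le_meanEnergy_hubbardTTPrime`, `exists_isTorusLimitOf_squareGroundStatesTT'_meanEnergy_eq`;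
`IsTorusLimitOf.abs_meanEnergy_diagHop_le`, `neg_sixteen_mul_abs_div_pi_sq_le_energyDensityTT'_diag`
(`HubbardOneBodyKinematicRows`); `energyDensityTT'_add_ge`, `energyDensityTT'_diag_free_ge`
(`HubbardNNNHoppingEnergyDensityRegionBounds`); `mem_szSector_iff`. `lean search 'sub_tPrime|lipschitz|diagHop.*Icc|
anchor' --decl` in Literature: only the `4n` Lipschitz law, the two-point antitone row and the anchor-chord
docc family — no endpoint-word transport, no cap transport along `t'`.

## References

* T. Koma, H. Tasaki, J. Stat. Phys. 76 (1994) 745, §1 (the ground-state energy is concave in a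
  coupling multiplying a term of the Hamiltonian; the conjugate observable is a monotone supergradient).
  [cite: KomaTasaki1994, §1]
* R. B. Griffiths, Phys. Rev. 152 (1966) 240, §II (one-sided derivatives of the energy bound the
  conjugate observable of every ground state). [cite: Griffiths1966, §II]
* R. B. Israel, *Convexity in the Theory of Lattice Gases* (1979), Thm. I.3.4 (Lipschitz continuity
  of thermodynamic functions in the interaction norm). [cite: Israel1979, Thm. I.3.4]
* J. Wang et al., PRX 14 (2024) 031006, §III (observable bounds valid for every state obeying an
  energy constraint). [cite: WangEtAl2024, §III]
* D. Ruelle, *Statistical Mechanics* (1969), §3.4 (variational principle for the energy density).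
  [cite: Ruelle1969, §3.4]
* E. H. Lieb, F. Y. Wu, Physica A 321 (2003) 1, §1 eq. (3) (the hole–particle transformation; at half
  filling `t' ↦ −t'` is a symmetry of the energy). [cite: LiebWuPhysicaA2003, §1 eq. (3)]
-/

noncomputable section

namespace Literature.MathematicalPhysics.QuantumLattice

open Matrix Finset HubbardWave0 Literature.Probability.LatticeModels ThermodynamicLimit
open _root_.Filter
open scoped _root_.Topology ComplexOrder BigOperators

namespace InfVolFermionState

/-! ### §1 The diagonal-hopping word is monotone-transported along `t'` -/

/-- **A ceiling word moves to the right.** If every torus-limit ground state `ω₁` at `(t, s₁, U)`,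
density `n` (`U ≥ 0`, `0 ≤ n < 2`), has `K₂(ω₁) ≤ A`, then every torus-limit ground state `ω` at
`(t, s, U)`, `s₁ ≤ s`, same density, has `K₂(ω) ≤ A` (`K₂` is antitone in `t'`; a ground state at `s₁`
exists). [cite: KomaTasaki1994, §1] [cite: Griffiths1966, §II] -/
theorem IsTorusLimitOf.meanEnergy_diagHop_le_of_forall_left (t : ℝ) {s₁ s : ℝ} (hs : s₁ ≤ s)
    {U : ℝ} (hU : 0 ≤ U) {n : ℝ} (hn0 : 0 ≤ n) (hn2 : n < 2) {A : ℝ}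
    (hA : ∀ (ω₁ : InfVolFermionState 2) (Ls₁ : ℕ → ℕ) (ψ₁ : ∀ L, Fock (Orb (FermionTorus 2 L))),
      Tendsto Ls₁ atTop atTop →
      (∀ j, IsGroundStateInSector (hubbardTorusTT' (Ls₁ j) t s₁ U) (rectN n (Ls₁ j)) 0 (ψ₁ (Ls₁ j))) →
      (∀ j, star (ψ₁ (Ls₁ j)) ⬝ᵥ ψ₁ (Ls₁ j) = 1) → ω₁.IsTorusLimitOf ψ₁ Ls₁ →
      ω₁.meanEnergy (hubbardTTPrimeFermionInteraction 0 1 0) 1 ≤ A)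
    {ω : InfVolFermionState 2} {ψ : ∀ L, Fock (Orb (FermionTorus 2 L))} {Ls : ℕ → ℕ}
    (h : ω.IsTorusLimitOf ψ Ls) (hLs : Tendsto Ls atTop atTop)
    (hψ : ∀ j, IsGroundStateInSector (hubbardTorusTT' (Ls j) t s U) (rectN n (Ls j)) 0 (ψ (Ls j)))
    (h1 : ∀ j, star (ψ (Ls j)) ⬝ᵥ ψ (Ls j) = 1) :
    ω.meanEnergy (hubbardTTPrimeFermionInteraction 0 1 0) 1 ≤ A := by
  rcases hs.eq_or_lt with heq | hlt
  · subst heq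
    exact hA ω Ls ψ hLs hψ h1 h
  · obtain ⟨ψ₁, Ls₁, ω₁, hLs₁, hω₁, -, -, h1₁, hψ₁, -, -, -⟩ :=
      exists_isTorusLimitOf_squareGroundStatesTT'_meanEnergy_eq t s₁ hU hn0 hn2
    exact (IsTorusLimitOf.diagHopEnergy_anti_of_groundStates t hlt hU hn0 hn2 hω₁ hLs₁ hψ₁ h1₁ h hLs
      hψ h1).trans (hA ω₁ Ls₁ ψ₁ hLs₁ hψ₁ h1₁ hω₁)

/-- **A floor word moves to the left.** If every torus-limit ground state `ω₂` at `(t, s₂, U)`, density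
`n`, has `B ≤ K₂(ω₂)`, then every torus-limit ground state `ω` at `(t, s, U)`, `s ≤ s₂`, same density,
has `B ≤ K₂(ω)`. [cite: KomaTasaki1994, §1] [cite: Griffiths1966, §II] -/
theorem IsTorusLimitOf.le_meanEnergy_diagHop_of_forall_right (t : ℝ) {s s₂ : ℝ} (hs : s ≤ s₂)
    {U : ℝ} (hU : 0 ≤ U) {n : ℝ} (hn0 : 0 ≤ n) (hn2 : n < 2) {B : ℝ}
    (hB : ∀ (ω₂ : InfVolFermionState 2) (Ls₂ : ℕ → ℕ) (ψ₂ : ∀ L, Fock (Orb (FermionTorus 2 L))),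
      Tendsto Ls₂ atTop atTop →
      (∀ j, IsGroundStateInSector (hubbardTorusTT' (Ls₂ j) t s₂ U) (rectN n (Ls₂ j)) 0 (ψ₂ (Ls₂ j))) →
      (∀ j, star (ψ₂ (Ls₂ j)) ⬝ᵥ ψ₂ (Ls₂ j) = 1) → ω₂.IsTorusLimitOf ψ₂ Ls₂ →
      B ≤ ω₂.meanEnergy (hubbardTTPrimeFermionInteraction 0 1 0) 1)
    {ω : InfVolFermionState 2} {ψ : ∀ L, Fock (Orb (FermionTorus 2 L))} {Ls : ℕ → ℕ}
    (h : ω.IsTorusLimitOf ψ Ls) (hLs : Tendsto Ls atTop atTop)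
    (hψ : ∀ j, IsGroundStateInSector (hubbardTorusTT' (Ls j) t s U) (rectN n (Ls j)) 0 (ψ (Ls j)))
    (h1 : ∀ j, star (ψ (Ls j)) ⬝ᵥ ψ (Ls j) = 1) :
    B ≤ ω.meanEnergy (hubbardTTPrimeFermionInteraction 0 1 0) 1 := by
  rcases hs.eq_or_lt with heq | hlt
  · subst heq
    exact hB ω Ls ψ hLs hψ h1 h
  · obtain ⟨ψ₂, Ls₂, ω₂, hLs₂, hω₂, -, -, h1₂, hψ₂, -, -, -⟩ :=
      exists_isTorusLimitOf_squareGroundStatesTT'_meanEnergy_eq t s₂ hU hn0 hn2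
    exact (hB ω₂ Ls₂ ψ₂ hLs₂ hψ₂ h1₂ hω₂).trans (IsTorusLimitOf.diagHopEnergy_anti_of_groundStates t hlt
      hU hn0 hn2 h hLs hψ h1 hω₂ hLs₂ hψ₂ h1₂)

/-- **The two endpoint words bracket `K₂` on the whole box**: a ceiling word `A` at `s₁` and a floor
word `B` at `s₂` give `B ≤ K₂(ω) ≤ A` for every torus-limit ground state `ω` at any `t' = s ∈ [s₁, s₂]`
(same `t`, `U ≥ 0`, density `n`). [cite: KomaTasaki1994, §1] [cite: Griffiths1966, §II] -/
theorem IsTorusLimitOf.meanEnergy_diagHop_mem_Icc_of_forall_endpoints (t : ℝ) {s₁ s₂ s : ℝ}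
    (hs : s ∈ Set.Icc s₁ s₂) {U : ℝ} (hU : 0 ≤ U) {n : ℝ} (hn0 : 0 ≤ n) (hn2 : n < 2) {A B : ℝ}
    (hA : ∀ (ω₁ : InfVolFermionState 2) (Ls₁ : ℕ → ℕ) (ψ₁ : ∀ L, Fock (Orb (FermionTorus 2 L))),
      Tendsto Ls₁ atTop atTop →
      (∀ j, IsGroundStateInSector (hubbardTorusTT' (Ls₁ j) t s₁ U) (rectN n (Ls₁ j)) 0 (ψ₁ (Ls₁ j))) →
      (∀ j, star (ψ₁ (Ls₁ j)) ⬝ᵥ ψ₁ (Ls₁ j) = 1) → ω₁.IsTorusLimitOf ψ₁ Ls₁ →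
      ω₁.meanEnergy (hubbardTTPrimeFermionInteraction 0 1 0) 1 ≤ A)
    (hB : ∀ (ω₂ : InfVolFermionState 2) (Ls₂ : ℕ → ℕ) (ψ₂ : ∀ L, Fock (Orb (FermionTorus 2 L))),
      Tendsto Ls₂ atTop atTop →
      (∀ j, IsGroundStateInSector (hubbardTorusTT' (Ls₂ j) t s₂ U) (rectN n (Ls₂ j)) 0 (ψ₂ (Ls₂ j))) →
      (∀ j, star (ψ₂ (Ls₂ j)) ⬝ᵥ ψ₂ (Ls₂ j) = 1) → ω₂.IsTorusLimitOf ψ₂ Ls₂ →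
      B ≤ ω₂.meanEnergy (hubbardTTPrimeFermionInteraction 0 1 0) 1)
    {ω : InfVolFermionState 2} {ψ : ∀ L, Fock (Orb (FermionTorus 2 L))} {Ls : ℕ → ℕ}
    (h : ω.IsTorusLimitOf ψ Ls) (hLs : Tendsto Ls atTop atTop)
    (hψ : ∀ j, IsGroundStateInSector (hubbardTorusTT' (Ls j) t s U) (rectN n (Ls j)) 0 (ψ (Ls j)))
    (h1 : ∀ j, star (ψ (Ls j)) ⬝ᵥ ψ (Ls j) = 1) :
    ω.meanEnergy (hubbardTTPrimeFermionInteraction 0 1 0) 1 ∈ Set.Icc B A :=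
  ⟨h.le_meanEnergy_diagHop_of_forall_right t hs.2 hU hn0 hn2 hB hLs hψ h1,
    h.meanEnergy_diagHop_le_of_forall_left t hs.1 hU hn0 hn2 hA hLs hψ h1⟩

/-! ### §2 The dilute kinematic row `|K₂(ω)| ≤ 4n` -/

/-- **`|K₂(ω)| ≤ 4n`** for every torus limit `ω` of unit `rectN n`-particle vectors (ground states or
not, `0 ≤ n < 2`): the variational inequality at the couplings `(0, ±1, 0)` and the free diagonal band
`e(0, t', 0, n) ≥ −4|t'| n` (each of the `n` particles per site pays at most the band edge `4|t'|`).
Better than the half-filled-band constant `16/π²` exactly when `n < 4/π²`.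
[cite: LiebLoss1993, §8, Theorem 8.2] [cite: Ruelle1969, §3.4] -/
theorem IsTorusLimitOf.abs_meanEnergy_diagHop_le_four_mul {n : ℝ} (hn0 : 0 ≤ n) (hn2 : n < 2)
    {ω : InfVolFermionState 2} {ψ : ∀ L, Fock (Orb (FermionTorus 2 L))} {Ls : ℕ → ℕ}
    (h : ω.IsTorusLimitOf ψ Ls) (hLs : Tendsto Ls atTop atTop)
    (hN : ∀ j, IsNParticle (rectN n (Ls j)) (ψ (Ls j)))
    (h1 : ∀ j, star (ψ (Ls j)) ⬝ᵥ ψ (Ls j) = 1) :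
    |ω.meanEnergy (hubbardTTPrimeFermionInteraction 0 1 0) 1| ≤ 4 * n := by
  have hv1 := h.energyDensityTT'_le_meanEnergy_hubbardTTPrime 0 1 le_rfl hn0 hn2 hLs hN h1
  have hv2 := h.energyDensityTT'_le_meanEnergy_hubbardTTPrime 0 (-1) le_rfl hn0 hn2 hLs hN h1
  have hf1 := energyDensityTT'_diag_free_ge 1 hn0 hn2
  have hf2 := energyDensityTT'_diag_free_ge (-1) hn0 hn2
  rw [abs_one] at hf1
  rw [abs_neg, abs_one] at hf2
  have hsm : ω.meanEnergy (hubbardTTPrimeFermionInteraction 0 (-1) 0) 1 =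
      -1 * ω.meanEnergy (hubbardTTPrimeFermionInteraction 0 1 0) 1 := by
    have hs := ω.meanEnergy_hubbardTTPrime_smul (-1) 0 1 0
    rwa [mul_zero, mul_one] at hs
  rw [hsm] at hv2
  rw [abs_le]
  constructor <;> linarith

/-! ### §3 Transport of the energy cap: a ground state of the box in the window of the anchor Hamiltonian -/

/-- **The cap-transport inequality (two ground states).** Let `ω₀` be a torus-limit ground state at the
ANCHOR `(t, s₀, U)` and `ω` one at `(t, s, U)`, both of density `n` (`U ≥ 0`, `0 ≤ n < 2`). Then the
energy of `ω` for the anchor interaction satisfies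
`e_{Φ(t,s₀,U)}(ω) ≤ e(t,s₀,U,n) + (s − s₀)·(K₂(ω₀) − K₂(ω))`
(affine identity `e_{Φ(t,s₀,U)}(ω) = e_{Φ(t,s,U)}(ω) + (s₀ − s)K₂(ω)`, `e_{Φ(t,s,U)}(ω) = e(t,s,U,n)`, and
the tangent inequality at the anchor `e(t,s,U,n) ≤ e(t,s₀,U,n) + (s − s₀)K₂(ω₀)`); the excess is
nonnegative by antitonicity and vanishes at `s = s₀`. [cite: KomaTasaki1994, §1] [cite: WangEtAl2024, §III] -/
theorem IsTorusLimitOf.meanEnergy_anchor_le_of_groundStates (t s₀ s : ℝ) {U : ℝ} (hU : 0 ≤ U) {n : ℝ}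
    (hn0 : 0 ≤ n) (hn2 : n < 2)
    {ω₀ ω : InfVolFermionState 2} {ψ₀ ψ : ∀ L, Fock (Orb (FermionTorus 2 L))} {Ls₀ Ls : ℕ → ℕ}
    (h₀ : ω₀.IsTorusLimitOf ψ₀ Ls₀) (hLs₀ : Tendsto Ls₀ atTop atTop)
    (hψ₀ : ∀ j, IsGroundStateInSector (hubbardTorusTT' (Ls₀ j) t s₀ U) (rectN n (Ls₀ j)) 0 (ψ₀ (Ls₀ j)))
    (h1₀ : ∀ j, star (ψ₀ (Ls₀ j)) ⬝ᵥ ψ₀ (Ls₀ j) = 1)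
    (h : ω.IsTorusLimitOf ψ Ls) (hLs : Tendsto Ls atTop atTop)
    (hψ : ∀ j, IsGroundStateInSector (hubbardTorusTT' (Ls j) t s U) (rectN n (Ls j)) 0 (ψ (Ls j)))
    (h1 : ∀ j, star (ψ (Ls j)) ⬝ᵥ ψ (Ls j) = 1) :
    ω.meanEnergy (hubbardTTPrimeFermionInteraction t s₀ U) 1 ≤
      energyDensityTT' t s₀ U n +
        (s - s₀) * (ω₀.meanEnergy (hubbardTTPrimeFermionInteraction 0 1 0) 1 -
          ω.meanEnergy (hubbardTTPrimeFermionInteraction 0 1 0) 1) := by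
  have haff := ω.meanEnergy_hubbardTTPrime_affine t s U s₀ U
  have hgs := h.meanEnergy_hubbardTTPrime_eq_energyDensityTT' t s hU hn0 hn2 hLs hψ h1
  have htan := h₀.energyDensityTT'_sub_le_mul_meanEnergy_diag t s₀ hU hn0 hn2 hLs₀ hψ₀ h1₀ s
  rw [haff, hgs, sub_self, zero_mul, add_zero]
  linarith

/-- **The window of the anchor Hamiltonian in which a ground state of the box sits (two ground states).**
Same data: `e(t,s₀,U,n) ≤ e_{Φ(t,s₀,U)}(ω) ≤ e(t,s₀,U,n) + (s − s₀)(K₂(ω₀) − K₂(ω))` — the lower end is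
the variational principle. [cite: Ruelle1969, §3.4] [cite: KomaTasaki1994, §1] -/
theorem IsTorusLimitOf.meanEnergy_anchor_mem_Icc_of_groundStates (t s₀ s : ℝ) {U : ℝ} (hU : 0 ≤ U)
    {n : ℝ} (hn0 : 0 ≤ n) (hn2 : n < 2)
    {ω₀ ω : InfVolFermionState 2} {ψ₀ ψ : ∀ L, Fock (Orb (FermionTorus 2 L))} {Ls₀ Ls : ℕ → ℕ}
    (h₀ : ω₀.IsTorusLimitOf ψ₀ Ls₀) (hLs₀ : Tendsto Ls₀ atTop atTop)
    (hψ₀ : ∀ j, IsGroundStateInSector (hubbardTorusTT' (Ls₀ j) t s₀ U) (rectN n (Ls₀ j)) 0 (ψ₀ (Ls₀ j)))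
    (h1₀ : ∀ j, star (ψ₀ (Ls₀ j)) ⬝ᵥ ψ₀ (Ls₀ j) = 1)
    (h : ω.IsTorusLimitOf ψ Ls) (hLs : Tendsto Ls atTop atTop)
    (hψ : ∀ j, IsGroundStateInSector (hubbardTorusTT' (Ls j) t s U) (rectN n (Ls j)) 0 (ψ (Ls j)))
    (h1 : ∀ j, star (ψ (Ls j)) ⬝ᵥ ψ (Ls j) = 1) :
    ω.meanEnergy (hubbardTTPrimeFermionInteraction t s₀ U) 1 ∈
      Set.Icc (energyDensityTT' t s₀ U n)
        (energyDensityTT' t s₀ U n +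
          (s - s₀) * (ω₀.meanEnergy (hubbardTTPrimeFermionInteraction 0 1 0) 1 -
            ω.meanEnergy (hubbardTTPrimeFermionInteraction 0 1 0) 1)) := by
  have hN : ∀ j, IsNParticle (rectN n (Ls j)) (ψ (Ls j)) := fun j =>
    ((mem_szSector_iff _ _ _).1 (hψ j).1).1
  exact ⟨h.energyDensityTT'_le_meanEnergy_hubbardTTPrime t s₀ hU hn0 hn2 hLs hN h1,
    IsTorusLimitOf.meanEnergy_anchor_le_of_groundStates t s₀ s hU hn0 hn2 h₀ hLs₀ hψ₀ h1₀ h hLs hψ h1⟩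

/-- **Cap transport to the right of the anchor, from words.** For `s₀ ≤ s ≤ s₂`, a certified cap
`e(t,s₀,U,n) ≤ u₀`, a ceiling word `A₀` at the anchor `s₀` and a floor word `B` at `s₂` (all at the same
`t`, `U ≥ 0`, density `n`): every torus-limit ground state `ω` at `(t, s, U)` has
`e_{Φ(t,s₀,U)}(ω) ≤ u₀ + (s − s₀)(A₀ − B)`. [cite: KomaTasaki1994, §1] [cite: WangEtAl2024, §III] -/
theorem IsTorusLimitOf.meanEnergy_anchor_le_of_forall_right (t : ℝ) {s₀ s s₂ : ℝ} (h0s : s₀ ≤ s)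
    (hs₂ : s ≤ s₂) {U : ℝ} (hU : 0 ≤ U) {n : ℝ} (hn0 : 0 ≤ n) (hn2 : n < 2) {u₀ A₀ B : ℝ}
    (hu₀ : energyDensityTT' t s₀ U n ≤ u₀)
    (hA₀ : ∀ (ω₀ : InfVolFermionState 2) (Ls₀ : ℕ → ℕ) (ψ₀ : ∀ L, Fock (Orb (FermionTorus 2 L))),
      Tendsto Ls₀ atTop atTop →
      (∀ j, IsGroundStateInSector (hubbardTorusTT' (Ls₀ j) t s₀ U) (rectN n (Ls₀ j)) 0 (ψ₀ (Ls₀ j))) →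
      (∀ j, star (ψ₀ (Ls₀ j)) ⬝ᵥ ψ₀ (Ls₀ j) = 1) → ω₀.IsTorusLimitOf ψ₀ Ls₀ →
      ω₀.meanEnergy (hubbardTTPrimeFermionInteraction 0 1 0) 1 ≤ A₀)
    (hB : ∀ (ω₂ : InfVolFermionState 2) (Ls₂ : ℕ → ℕ) (ψ₂ : ∀ L, Fock (Orb (FermionTorus 2 L))),
      Tendsto Ls₂ atTop atTop →
      (∀ j, IsGroundStateInSector (hubbardTorusTT' (Ls₂ j) t s₂ U) (rectN n (Ls₂ j)) 0 (ψ₂ (Ls₂ j))) →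
      (∀ j, star (ψ₂ (Ls₂ j)) ⬝ᵥ ψ₂ (Ls₂ j) = 1) → ω₂.IsTorusLimitOf ψ₂ Ls₂ →
      B ≤ ω₂.meanEnergy (hubbardTTPrimeFermionInteraction 0 1 0) 1)
    {ω : InfVolFermionState 2} {ψ : ∀ L, Fock (Orb (FermionTorus 2 L))} {Ls : ℕ → ℕ}
    (h : ω.IsTorusLimitOf ψ Ls) (hLs : Tendsto Ls atTop atTop)
    (hψ : ∀ j, IsGroundStateInSector (hubbardTorusTT' (Ls j) t s U) (rectN n (Ls j)) 0 (ψ (Ls j)))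
    (h1 : ∀ j, star (ψ (Ls j)) ⬝ᵥ ψ (Ls j) = 1) :
    ω.meanEnergy (hubbardTTPrimeFermionInteraction t s₀ U) 1 ≤ u₀ + (s - s₀) * (A₀ - B) := by
  obtain ⟨ψ₀, Ls₀, ω₀, hLs₀, hω₀, -, -, h1₀, hψ₀, -, -, -⟩ :=
    exists_isTorusLimitOf_squareGroundStatesTT'_meanEnergy_eq t s₀ hU hn0 hn2
  have hmain := IsTorusLimitOf.meanEnergy_anchor_le_of_groundStates t s₀ s hU hn0 hn2 hω₀ hLs₀ hψ₀ h1₀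
    h hLs hψ h1
  have hK₀ := hA₀ ω₀ Ls₀ ψ₀ hLs₀ hψ₀ h1₀ hω₀
  have hK := h.le_meanEnergy_diagHop_of_forall_right t hs₂ hU hn0 hn2 hB hLs hψ h1
  have hprod := mul_le_mul_of_nonneg_left
    (show ω₀.meanEnergy (hubbardTTPrimeFermionInteraction 0 1 0) 1 -
        ω.meanEnergy (hubbardTTPrimeFermionInteraction 0 1 0) 1 ≤ A₀ - B by linarith)
    (sub_nonneg.2 h0s)
  linarith

/-- **Cap transport to the left of the anchor, from words.** For `s₁ ≤ s ≤ s₀`, a certified cap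
`e(t,s₀,U,n) ≤ u₀`, a floor word `B₀` at the anchor and a ceiling word `A` at `s₁`: every torus-limit
ground state `ω` at `(t, s, U)` has `e_{Φ(t,s₀,U)}(ω) ≤ u₀ + (s₀ − s)(A − B₀)`.
[cite: KomaTasaki1994, §1] [cite: WangEtAl2024, §III] -/
theorem IsTorusLimitOf.meanEnergy_anchor_le_of_forall_left (t : ℝ) {s₁ s s₀ : ℝ} (hs₁ : s₁ ≤ s)
    (hs0 : s ≤ s₀) {U : ℝ} (hU : 0 ≤ U) {n : ℝ} (hn0 : 0 ≤ n) (hn2 : n < 2) {u₀ A B₀ : ℝ}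
    (hu₀ : energyDensityTT' t s₀ U n ≤ u₀)
    (hA : ∀ (ω₁ : InfVolFermionState 2) (Ls₁ : ℕ → ℕ) (ψ₁ : ∀ L, Fock (Orb (FermionTorus 2 L))),
      Tendsto Ls₁ atTop atTop →
      (∀ j, IsGroundStateInSector (hubbardTorusTT' (Ls₁ j) t s₁ U) (rectN n (Ls₁ j)) 0 (ψ₁ (Ls₁ j))) →
      (∀ j, star (ψ₁ (Ls₁ j)) ⬝ᵥ ψ₁ (Ls₁ j) = 1) → ω₁.IsTorusLimitOf ψ₁ Ls₁ →
      ω₁.meanEnergy (hubbardTTPrimeFermionInteraction 0 1 0) 1 ≤ A)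
    (hB₀ : ∀ (ω₀ : InfVolFermionState 2) (Ls₀ : ℕ → ℕ) (ψ₀ : ∀ L, Fock (Orb (FermionTorus 2 L))),
      Tendsto Ls₀ atTop atTop →
      (∀ j, IsGroundStateInSector (hubbardTorusTT' (Ls₀ j) t s₀ U) (rectN n (Ls₀ j)) 0 (ψ₀ (Ls₀ j))) →
      (∀ j, star (ψ₀ (Ls₀ j)) ⬝ᵥ ψ₀ (Ls₀ j) = 1) → ω₀.IsTorusLimitOf ψ₀ Ls₀ →
      B₀ ≤ ω₀.meanEnergy (hubbardTTPrimeFermionInteraction 0 1 0) 1)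
    {ω : InfVolFermionState 2} {ψ : ∀ L, Fock (Orb (FermionTorus 2 L))} {Ls : ℕ → ℕ}
    (h : ω.IsTorusLimitOf ψ Ls) (hLs : Tendsto Ls atTop atTop)
    (hψ : ∀ j, IsGroundStateInSector (hubbardTorusTT' (Ls j) t s U) (rectN n (Ls j)) 0 (ψ (Ls j)))
    (h1 : ∀ j, star (ψ (Ls j)) ⬝ᵥ ψ (Ls j) = 1) :
    ω.meanEnergy (hubbardTTPrimeFermionInteraction t s₀ U) 1 ≤ u₀ + (s₀ - s) * (A - B₀) := by
  obtain ⟨ψ₀, Ls₀, ω₀, hLs₀, hω₀, -, -, h1₀, hψ₀, -, -, -⟩ :=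
    exists_isTorusLimitOf_squareGroundStatesTT'_meanEnergy_eq t s₀ hU hn0 hn2
  have hmain := IsTorusLimitOf.meanEnergy_anchor_le_of_groundStates t s₀ s hU hn0 hn2 hω₀ hLs₀ hψ₀ h1₀
    h hLs hψ h1
  have hK₀ := hB₀ ω₀ Ls₀ ψ₀ hLs₀ hψ₀ h1₀ hω₀
  have hK := h.meanEnergy_diagHop_le_of_forall_left t hs₁ hU hn0 hn2 hA hLs hψ h1
  have hprod := mul_le_mul_of_nonneg_left
    (show ω.meanEnergy (hubbardTTPrimeFermionInteraction 0 1 0) 1 -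
        ω₀.meanEnergy (hubbardTTPrimeFermionInteraction 0 1 0) 1 ≤ A - B₀ by linarith)
    (sub_nonneg.2 hs0)
  have e1 : (s - s₀) * (ω₀.meanEnergy (hubbardTTPrimeFermionInteraction 0 1 0) 1 -
      ω.meanEnergy (hubbardTTPrimeFermionInteraction 0 1 0) 1) =
      (s₀ - s) * (ω.meanEnergy (hubbardTTPrimeFermionInteraction 0 1 0) 1 -
        ω₀.meanEnergy (hubbardTTPrimeFermionInteraction 0 1 0) 1) := by ring
  rw [e1] at hmain
  linarith

/-- **Cap transport anywhere in the box from the two ENDPOINT words alone.** For a box `[s₁, s₂]` with a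
ceiling word `A` at `s₁` and a floor word `B` at `s₂`, an anchor `s₀ ∈ [s₁, s₂]`, and every torus-limit
ground state `ω` at any `t' = s ∈ [s₁, s₂]` (same `t`, `U ≥ 0`, density `n`):
`e(t,s₀,U,n) ≤ e_{Φ(t,s₀,U)}(ω) ≤ e(t,s₀,U,n) + |s − s₀|·(A − B)` — both `K₂(ω₀)` and `K₂(ω)` lie in
`[B, A]` by §1. This is the window-inflation an anchor certificate must be booked with in order to cover
the box. [cite: KomaTasaki1994, §1] [cite: WangEtAl2024, §III] -/
theorem IsTorusLimitOf.meanEnergy_anchor_mem_Icc_of_forall_endpoints (t : ℝ) {s₁ s₂ s₀ s : ℝ}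
    (hs₀ : s₀ ∈ Set.Icc s₁ s₂) (hs : s ∈ Set.Icc s₁ s₂) {U : ℝ} (hU : 0 ≤ U) {n : ℝ} (hn0 : 0 ≤ n)
    (hn2 : n < 2) {A B : ℝ}
    (hA : ∀ (ω₁ : InfVolFermionState 2) (Ls₁ : ℕ → ℕ) (ψ₁ : ∀ L, Fock (Orb (FermionTorus 2 L))),
      Tendsto Ls₁ atTop atTop →
      (∀ j, IsGroundStateInSector (hubbardTorusTT' (Ls₁ j) t s₁ U) (rectN n (Ls₁ j)) 0 (ψ₁ (Ls₁ j))) →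
      (∀ j, star (ψ₁ (Ls₁ j)) ⬝ᵥ ψ₁ (Ls₁ j) = 1) → ω₁.IsTorusLimitOf ψ₁ Ls₁ →
      ω₁.meanEnergy (hubbardTTPrimeFermionInteraction 0 1 0) 1 ≤ A)
    (hB : ∀ (ω₂ : InfVolFermionState 2) (Ls₂ : ℕ → ℕ) (ψ₂ : ∀ L, Fock (Orb (FermionTorus 2 L))),
      Tendsto Ls₂ atTop atTop →
      (∀ j, IsGroundStateInSector (hubbardTorusTT' (Ls₂ j) t s₂ U) (rectN n (Ls₂ j)) 0 (ψ₂ (Ls₂ j))) →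
      (∀ j, star (ψ₂ (Ls₂ j)) ⬝ᵥ ψ₂ (Ls₂ j) = 1) → ω₂.IsTorusLimitOf ψ₂ Ls₂ →
      B ≤ ω₂.meanEnergy (hubbardTTPrimeFermionInteraction 0 1 0) 1)
    {ω : InfVolFermionState 2} {ψ : ∀ L, Fock (Orb (FermionTorus 2 L))} {Ls : ℕ → ℕ}
    (h : ω.IsTorusLimitOf ψ Ls) (hLs : Tendsto Ls atTop atTop)
    (hψ : ∀ j, IsGroundStateInSector (hubbardTorusTT' (Ls j) t s U) (rectN n (Ls j)) 0 (ψ (Ls j)))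
    (h1 : ∀ j, star (ψ (Ls j)) ⬝ᵥ ψ (Ls j) = 1) :
    ω.meanEnergy (hubbardTTPrimeFermionInteraction t s₀ U) 1 ∈
      Set.Icc (energyDensityTT' t s₀ U n) (energyDensityTT' t s₀ U n + |s - s₀| * (A - B)) := by
  obtain ⟨ψ₀, Ls₀, ω₀, hLs₀, hω₀, -, -, h1₀, hψ₀, -, -, -⟩ :=
    exists_isTorusLimitOf_squareGroundStatesTT'_meanEnergy_eq t s₀ hU hn0 hn2
  obtain ⟨hlo, hhi⟩ := IsTorusLimitOf.meanEnergy_anchor_mem_Icc_of_groundStates t s₀ s hU hn0 hn2 hω₀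
    hLs₀ hψ₀ h1₀ h hLs hψ h1
  refine ⟨hlo, hhi.trans ?_⟩
  obtain ⟨hB₀, hA₀⟩ := hω₀.meanEnergy_diagHop_mem_Icc_of_forall_endpoints t hs₀ hU hn0 hn2 hA hB hLs₀
    hψ₀ h1₀
  obtain ⟨hBω, hAω⟩ := h.meanEnergy_diagHop_mem_Icc_of_forall_endpoints t hs hU hn0 hn2 hA hB hLs hψ h1
  set x := ω₀.meanEnergy (hubbardTTPrimeFermionInteraction 0 1 0) 1 -
    ω.meanEnergy (hubbardTTPrimeFermionInteraction 0 1 0) 1 with hx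
  have hxabs : |x| ≤ A - B := abs_le.2 ⟨by linarith, by linarith⟩
  have hle : (s - s₀) * x ≤ |s - s₀| * (A - B) :=
    calc (s - s₀) * x ≤ |(s - s₀) * x| := le_abs_self _
      _ = |s - s₀| * |x| := abs_mul _ _
      _ ≤ |s - s₀| * (A - B) := mul_le_mul_of_nonneg_left hxabs (abs_nonneg _)
  linarith

/-- **Word-free cap transport (kinematic constant).** For ANY two values `s₀, s` of `t'` (same `t`,
`U ≥ 0`, density `0 ≤ n < 2`) and every torus-limit ground state `ω` at `(t, s, U)`:
`e(t,s₀,U,n) ≤ e_{Φ(t,s₀,U)}(ω) ≤ e(t,s₀,U,n) + (32/π²)·|s − s₀|` (both slopes obey the kinematic row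
`|K₂| ≤ 16/π²`). [cite: LiebLoss1993, §8, Theorem 8.2] [cite: KomaTasaki1994, §1] -/
theorem IsTorusLimitOf.meanEnergy_anchor_mem_Icc_kinematic (t s₀ s : ℝ) {U : ℝ} (hU : 0 ≤ U) {n : ℝ}
    (hn0 : 0 ≤ n) (hn2 : n < 2)
    {ω : InfVolFermionState 2} {ψ : ∀ L, Fock (Orb (FermionTorus 2 L))} {Ls : ℕ → ℕ}
    (h : ω.IsTorusLimitOf ψ Ls) (hLs : Tendsto Ls atTop atTop)
    (hψ : ∀ j, IsGroundStateInSector (hubbardTorusTT' (Ls j) t s U) (rectN n (Ls j)) 0 (ψ (Ls j)))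
    (h1 : ∀ j, star (ψ (Ls j)) ⬝ᵥ ψ (Ls j) = 1) :
    ω.meanEnergy (hubbardTTPrimeFermionInteraction t s₀ U) 1 ∈
      Set.Icc (energyDensityTT' t s₀ U n) (energyDensityTT' t s₀ U n + 32 / Real.pi ^ 2 * |s - s₀|) := by
  obtain ⟨ψ₀, Ls₀, ω₀, hLs₀, hω₀, -, -, h1₀, hψ₀, -, -, -⟩ :=
    exists_isTorusLimitOf_squareGroundStatesTT'_meanEnergy_eq t s₀ hU hn0 hn2
  obtain ⟨hlo, hhi⟩ := IsTorusLimitOf.meanEnergy_anchor_mem_Icc_of_groundStates t s₀ s hU hn0 hn2 hω₀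
    hLs₀ hψ₀ h1₀ h hLs hψ h1
  refine ⟨hlo, hhi.trans ?_⟩
  have hN₀ : ∀ j, IsNParticle (rectN n (Ls₀ j)) (ψ₀ (Ls₀ j)) := fun j =>
    ((mem_szSector_iff _ _ _).1 (hψ₀ j).1).1
  have hN : ∀ j, IsNParticle (rectN n (Ls j)) (ψ (Ls j)) := fun j =>
    ((mem_szSector_iff _ _ _).1 (hψ j).1).1
  have hK₀ := hω₀.abs_meanEnergy_diagHop_le hn0 hn2 hLs₀ hN₀ h1₀
  have hK := h.abs_meanEnergy_diagHop_le hn0 hn2 hLs hN h1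
  set x := ω₀.meanEnergy (hubbardTTPrimeFermionInteraction 0 1 0) 1 -
    ω.meanEnergy (hubbardTTPrimeFermionInteraction 0 1 0) 1 with hx
  have hxabs : |x| ≤ 32 / Real.pi ^ 2 := by
    calc |x| ≤ |ω₀.meanEnergy (hubbardTTPrimeFermionInteraction 0 1 0) 1| +
          |ω.meanEnergy (hubbardTTPrimeFermionInteraction 0 1 0) 1| := abs_sub _ _
      _ ≤ 16 / Real.pi ^ 2 + 16 / Real.pi ^ 2 := add_le_add hK₀ hK
      _ = 32 / Real.pi ^ 2 := by ring
  have hle : (s - s₀) * x ≤ 32 / Real.pi ^ 2 * |s - s₀| :=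
    calc (s - s₀) * x ≤ |(s - s₀) * x| := le_abs_self _
      _ = |s - s₀| * |x| := abs_mul _ _
      _ ≤ |s - s₀| * (32 / Real.pi ^ 2) := mul_le_mul_of_nonneg_left hxabs (abs_nonneg _)
      _ = 32 / Real.pi ^ 2 * |s - s₀| := mul_comm _ _
  linarith

/-! ### §4 BOX ⇒ WORD: a cap-class property at the anchor holds for every ground state of the box -/

/-- **BOX ⇒ WORD (endpoint words).** Fix `t`, `U ≥ 0`, a density `0 ≤ n < 2`, a box `[s₁, s₂]` of
next-nearest-neighbour hoppings with a ceiling word `A` at `s₁` and a floor word `B` at `s₂`, an anchor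
`s₀ ∈ [s₁, s₂]` with a certified cap `e(t,s₀,U,n) ≤ u₀`, and a property `P` of infinite-volume states that
holds for every torus limit `ω` (along some `Ls → ∞`) of unit `rectN n`-particle vectors whose anchor
energy is capped, `e_{Φ(t,s₀,U)}(ω) ≤ u` — the conclusion of a certificate at the anchor whose state
hypotheses are the cap and state-independent rows only. If the cap was booked with the box inflation,
`u₀ + max(s₂ − s₀, s₀ − s₁)·(A − B) ≤ u`, then `P ω` for every torus-limit ground state `ω` at every
`t' = s ∈ [s₁, s₂]`. [cite: WangEtAl2024, §III] [cite: KomaTasaki1994, §1] -/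
theorem forall_groundState_tPrime_box_of_forall_cap (t : ℝ) {s₁ s₂ s₀ : ℝ} (hs₀ : s₀ ∈ Set.Icc s₁ s₂)
    {U : ℝ} (hU : 0 ≤ U) {n : ℝ} (hn0 : 0 ≤ n) (hn2 : n < 2) {u₀ u A B : ℝ}
    (hu₀ : energyDensityTT' t s₀ U n ≤ u₀)
    (hA : ∀ (ω₁ : InfVolFermionState 2) (Ls₁ : ℕ → ℕ) (ψ₁ : ∀ L, Fock (Orb (FermionTorus 2 L))),
      Tendsto Ls₁ atTop atTop →
      (∀ j, IsGroundStateInSector (hubbardTorusTT' (Ls₁ j) t s₁ U) (rectN n (Ls₁ j)) 0 (ψ₁ (Ls₁ j))) →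
      (∀ j, star (ψ₁ (Ls₁ j)) ⬝ᵥ ψ₁ (Ls₁ j) = 1) → ω₁.IsTorusLimitOf ψ₁ Ls₁ →
      ω₁.meanEnergy (hubbardTTPrimeFermionInteraction 0 1 0) 1 ≤ A)
    (hB : ∀ (ω₂ : InfVolFermionState 2) (Ls₂ : ℕ → ℕ) (ψ₂ : ∀ L, Fock (Orb (FermionTorus 2 L))),
      Tendsto Ls₂ atTop atTop →
      (∀ j, IsGroundStateInSector (hubbardTorusTT' (Ls₂ j) t s₂ U) (rectN n (Ls₂ j)) 0 (ψ₂ (Ls₂ j))) →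
      (∀ j, star (ψ₂ (Ls₂ j)) ⬝ᵥ ψ₂ (Ls₂ j) = 1) → ω₂.IsTorusLimitOf ψ₂ Ls₂ →
      B ≤ ω₂.meanEnergy (hubbardTTPrimeFermionInteraction 0 1 0) 1)
    (hu : u₀ + max (s₂ - s₀) (s₀ - s₁) * (A - B) ≤ u)
    {P : InfVolFermionState 2 → Prop}
    (hP : ∀ (ω : InfVolFermionState 2) (Ls : ℕ → ℕ) (ψ : ∀ L, Fock (Orb (FermionTorus 2 L))),
      Tendsto Ls atTop atTop → (∀ j, IsNParticle (rectN n (Ls j)) (ψ (Ls j))) →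
      (∀ j, star (ψ (Ls j)) ⬝ᵥ ψ (Ls j) = 1) → ω.IsTorusLimitOf ψ Ls →
      ω.meanEnergy (hubbardTTPrimeFermionInteraction t s₀ U) 1 ≤ u → P ω)
    {s : ℝ} (hs : s ∈ Set.Icc s₁ s₂)
    {ω : InfVolFermionState 2} {ψ : ∀ L, Fock (Orb (FermionTorus 2 L))} {Ls : ℕ → ℕ}
    (h : ω.IsTorusLimitOf ψ Ls) (hLs : Tendsto Ls atTop atTop)
    (hψ : ∀ j, IsGroundStateInSector (hubbardTorusTT' (Ls j) t s U) (rectN n (Ls j)) 0 (ψ (Ls j)))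
    (h1 : ∀ j, star (ψ (Ls j)) ⬝ᵥ ψ (Ls j) = 1) : P ω := by
  have hN : ∀ j, IsNParticle (rectN n (Ls j)) (ψ (Ls j)) := fun j =>
    ((mem_szSector_iff _ _ _).1 (hψ j).1).1
  refine hP ω Ls ψ hLs hN h1 h ?_
  obtain ⟨-, hcap⟩ := h.meanEnergy_anchor_mem_Icc_of_forall_endpoints t hs₀ hs hU hn0 hn2 hA hB hLs hψ h1
  obtain ⟨hBω, hAω⟩ := h.meanEnergy_diagHop_mem_Icc_of_forall_endpoints t hs hU hn0 hn2 hA hB hLs hψ h1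
  have hAB : 0 ≤ A - B := by linarith
  have hdist : |s - s₀| ≤ max (s₂ - s₀) (s₀ - s₁) := by
    rw [abs_le]
    constructor
    · have := le_max_right (s₂ - s₀) (s₀ - s₁)
      linarith [hs.1]
    · have := le_max_left (s₂ - s₀) (s₀ - s₁)
      linarith [hs.2]
  have := mul_le_mul_of_nonneg_right hdist hAB
  linarith

/-- **BOX ⇒ WORD (kinematic, no words).** As `forall_groundState_tPrime_box_of_forall_cap`, with the
universal inflation `u₀ + (32/π²)·max(s₂ − s₀, s₀ − s₁) ≤ u` in place of the endpoint words (here the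
anchor `s₀` need not lie in the box). [cite: WangEtAl2024, §III] [cite: LiebLoss1993, §8, Theorem 8.2] -/
theorem forall_groundState_tPrime_box_of_forall_cap_kinematic (t : ℝ) {s₁ s₂ : ℝ} (s₀ : ℝ)
    {U : ℝ} (hU : 0 ≤ U) {n : ℝ} (hn0 : 0 ≤ n) (hn2 : n < 2) {u₀ u : ℝ}
    (hu₀ : energyDensityTT' t s₀ U n ≤ u₀)
    (hu : u₀ + 32 / Real.pi ^ 2 * max (s₂ - s₀) (s₀ - s₁) ≤ u)
    {P : InfVolFermionState 2 → Prop}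
    (hP : ∀ (ω : InfVolFermionState 2) (Ls : ℕ → ℕ) (ψ : ∀ L, Fock (Orb (FermionTorus 2 L))),
      Tendsto Ls atTop atTop → (∀ j, IsNParticle (rectN n (Ls j)) (ψ (Ls j))) →
      (∀ j, star (ψ (Ls j)) ⬝ᵥ ψ (Ls j) = 1) → ω.IsTorusLimitOf ψ Ls →
      ω.meanEnergy (hubbardTTPrimeFermionInteraction t s₀ U) 1 ≤ u → P ω)
    {s : ℝ} (hs : s ∈ Set.Icc s₁ s₂)
    {ω : InfVolFermionState 2} {ψ : ∀ L, Fock (Orb (FermionTorus 2 L))} {Ls : ℕ → ℕ}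
    (h : ω.IsTorusLimitOf ψ Ls) (hLs : Tendsto Ls atTop atTop)
    (hψ : ∀ j, IsGroundStateInSector (hubbardTorusTT' (Ls j) t s U) (rectN n (Ls j)) 0 (ψ (Ls j)))
    (h1 : ∀ j, star (ψ (Ls j)) ⬝ᵥ ψ (Ls j) = 1) : P ω := by
  have hN : ∀ j, IsNParticle (rectN n (Ls j)) (ψ (Ls j)) := fun j =>
    ((mem_szSector_iff _ _ _).1 (hψ j).1).1
  refine hP ω Ls ψ hLs hN h1 h ?_
  obtain ⟨-, hcap⟩ := h.meanEnergy_anchor_mem_Icc_kinematic t s₀ s hU hn0 hn2 hLs hψ h1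
  have hdist : |s - s₀| ≤ max (s₂ - s₀) (s₀ - s₁) := by
    rw [abs_le]
    constructor
    · have := le_max_right (s₂ - s₀) (s₀ - s₁)
      linarith [hs.1]
    · have := le_max_left (s₂ - s₀) (s₀ - s₁)
      linarith [hs.2]
  have := mul_le_mul_of_nonneg_left hdist (show (0 : ℝ) ≤ 32 / Real.pi ^ 2 by positivity)
  linarith

end InfVolFermionState

/-! ### §5 Energy increments inside the box from the endpoint words; the certified Lipschitz constant -/

namespace ThermodynamicLimit

open InfVolFermionState

/-- **Upper slope from a ceiling word on the left.** For `s₁ ≤ s ≤ s'`, `U ≥ 0`, `0 ≤ n < 2` and a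
ceiling word `A` at `s₁` (every torus-limit ground state at `(t, s₁, U)`, density `n`, has `K₂ ≤ A`):
`e(t,s',U,n) − e(t,s,U,n) ≤ A·(s' − s)` (tangent at a ground state at `s`, whose slope is `≤ A` by §1).
[cite: KomaTasaki1994, §1] [cite: Griffiths1966, §II] -/
theorem energyDensityTT'_sub_le_mul_of_forall_diagHop_le (t : ℝ) {s₁ s s' : ℝ} (h₁ : s₁ ≤ s)
    (hss' : s ≤ s') {U : ℝ} (hU : 0 ≤ U) {n : ℝ} (hn0 : 0 ≤ n) (hn2 : n < 2) {A : ℝ}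
    (hA : ∀ (ω₁ : InfVolFermionState 2) (Ls₁ : ℕ → ℕ) (ψ₁ : ∀ L, Fock (Orb (FermionTorus 2 L))),
      Tendsto Ls₁ atTop atTop →
      (∀ j, IsGroundStateInSector (hubbardTorusTT' (Ls₁ j) t s₁ U) (rectN n (Ls₁ j)) 0 (ψ₁ (Ls₁ j))) →
      (∀ j, star (ψ₁ (Ls₁ j)) ⬝ᵥ ψ₁ (Ls₁ j) = 1) → ω₁.IsTorusLimitOf ψ₁ Ls₁ →
      ω₁.meanEnergy (hubbardTTPrimeFermionInteraction 0 1 0) 1 ≤ A) :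
    energyDensityTT' t s' U n - energyDensityTT' t s U n ≤ A * (s' - s) := by
  obtain ⟨ψ, Ls, ω, hLs, hω, -, -, h1, hψ, -, -, -⟩ :=
    exists_isTorusLimitOf_squareGroundStatesTT'_meanEnergy_eq t s hU hn0 hn2
  have htan := hω.energyDensityTT'_sub_le_mul_meanEnergy_diag t s hU hn0 hn2 hLs hψ h1 s'
  have hK := hω.meanEnergy_diagHop_le_of_forall_left t h₁ hU hn0 hn2 hA hLs hψ h1
  have hprod := mul_le_mul_of_nonneg_left hK (sub_nonneg.2 hss')
  linarith

/-- **Lower slope from a floor word on the right.** For `s ≤ s' ≤ s₂`, `U ≥ 0`, `0 ≤ n < 2` and a floor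
word `B` at `s₂`: `B·(s' − s) ≤ e(t,s',U,n) − e(t,s,U,n)` (tangent at a ground state at `s'`, whose
slope is `≥ B`). [cite: KomaTasaki1994, §1] [cite: Griffiths1966, §II] -/
theorem mul_le_energyDensityTT'_sub_of_forall_le_diagHop (t : ℝ) {s s' s₂ : ℝ} (hss' : s ≤ s')
    (h₂ : s' ≤ s₂) {U : ℝ} (hU : 0 ≤ U) {n : ℝ} (hn0 : 0 ≤ n) (hn2 : n < 2) {B : ℝ}
    (hB : ∀ (ω₂ : InfVolFermionState 2) (Ls₂ : ℕ → ℕ) (ψ₂ : ∀ L, Fock (Orb (FermionTorus 2 L))),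
      Tendsto Ls₂ atTop atTop →
      (∀ j, IsGroundStateInSector (hubbardTorusTT' (Ls₂ j) t s₂ U) (rectN n (Ls₂ j)) 0 (ψ₂ (Ls₂ j))) →
      (∀ j, star (ψ₂ (Ls₂ j)) ⬝ᵥ ψ₂ (Ls₂ j) = 1) → ω₂.IsTorusLimitOf ψ₂ Ls₂ →
      B ≤ ω₂.meanEnergy (hubbardTTPrimeFermionInteraction 0 1 0) 1) :
    B * (s' - s) ≤ energyDensityTT' t s' U n - energyDensityTT' t s U n := by
  obtain ⟨ψ, Ls, ω, hLs, hω, -, -, h1, hψ, -, -, -⟩ :=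
    exists_isTorusLimitOf_squareGroundStatesTT'_meanEnergy_eq t s' hU hn0 hn2
  have htan := hω.energyDensityTT'_sub_le_mul_meanEnergy_diag t s' hU hn0 hn2 hLs hψ h1 s
  have hK := hω.le_meanEnergy_diagHop_of_forall_right t h₂ hU hn0 hn2 hB hLs hψ h1
  have hprod := mul_le_mul_of_nonneg_left hK (sub_nonneg.2 hss')
  linarith

/-- **Two-sided energy increments on the box from the endpoint words**: for `s₁ ≤ s ≤ s' ≤ s₂`, a ceiling
word `A` at `s₁` and a floor word `B` at `s₂`,
`e(t,s',U,n) − e(t,s,U,n) ∈ [B(s' − s), A(s' − s)]`. [cite: KomaTasaki1994, §1] [cite: Griffiths1966, §II] -/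
theorem energyDensityTT'_sub_mem_Icc_of_forall_endpoints (t : ℝ) {s₁ s s' s₂ : ℝ} (h₁ : s₁ ≤ s)
    (hss' : s ≤ s') (h₂ : s' ≤ s₂) {U : ℝ} (hU : 0 ≤ U) {n : ℝ} (hn0 : 0 ≤ n) (hn2 : n < 2) {A B : ℝ}
    (hA : ∀ (ω₁ : InfVolFermionState 2) (Ls₁ : ℕ → ℕ) (ψ₁ : ∀ L, Fock (Orb (FermionTorus 2 L))),
      Tendsto Ls₁ atTop atTop →
      (∀ j, IsGroundStateInSector (hubbardTorusTT' (Ls₁ j) t s₁ U) (rectN n (Ls₁ j)) 0 (ψ₁ (Ls₁ j))) →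
      (∀ j, star (ψ₁ (Ls₁ j)) ⬝ᵥ ψ₁ (Ls₁ j) = 1) → ω₁.IsTorusLimitOf ψ₁ Ls₁ →
      ω₁.meanEnergy (hubbardTTPrimeFermionInteraction 0 1 0) 1 ≤ A)
    (hB : ∀ (ω₂ : InfVolFermionState 2) (Ls₂ : ℕ → ℕ) (ψ₂ : ∀ L, Fock (Orb (FermionTorus 2 L))),
      Tendsto Ls₂ atTop atTop →
      (∀ j, IsGroundStateInSector (hubbardTorusTT' (Ls₂ j) t s₂ U) (rectN n (Ls₂ j)) 0 (ψ₂ (Ls₂ j))) →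
      (∀ j, star (ψ₂ (Ls₂ j)) ⬝ᵥ ψ₂ (Ls₂ j) = 1) → ω₂.IsTorusLimitOf ψ₂ Ls₂ →
      B ≤ ω₂.meanEnergy (hubbardTTPrimeFermionInteraction 0 1 0) 1) :
    energyDensityTT' t s' U n - energyDensityTT' t s U n ∈ Set.Icc (B * (s' - s)) (A * (s' - s)) :=
  ⟨mul_le_energyDensityTT'_sub_of_forall_le_diagHop t hss' h₂ hU hn0 hn2 hB,
    energyDensityTT'_sub_le_mul_of_forall_diagHop_le t h₁ hss' hU hn0 hn2 hA⟩

/-- From `l·d ≤ x ≤ u·d` with `d ≥ 0`: `|x| ≤ max(|u|,|l|)·d`. [folklore] -/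
private theorem abs_le_max_abs_mul {x d l u : ℝ} (hd : 0 ≤ d) (hl : l * d ≤ x) (hu : x ≤ u * d) :
    |x| ≤ max |u| |l| * d := by
  rw [abs_le]
  constructor
  · have hml : -(max |u| |l|) ≤ l := by
      have h1 := neg_abs_le l
      have h2 := le_max_right |u| |l|
      linarith
    calc -(max |u| |l| * d) = (-(max |u| |l|)) * d := by ring
      _ ≤ l * d := mul_le_mul_of_nonneg_right hml hd
      _ ≤ x := hl
  · have hmu : u ≤ max |u| |l| := (le_abs_self u).trans (le_max_left _ _)
    exact hu.trans (mul_le_mul_of_nonneg_right hmu hd)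

/-- **The certified Lipschitz constant of `t' ↦ e` on a box from the endpoint hopping words**: with a
ceiling word `A` at `s₁` and a floor word `B` at `s₂`, for all `s, s' ∈ [s₁, s₂]`,
`|e(t,s,U,n) − e(t,s',U,n)| ≤ max(|A|,|B|)·|s − s'|` (`U ≥ 0`, `0 ≤ n < 2`). Since every word obeys the
kinematic range, `max(|A|,|B|) ≤ 16/π²` can always be achieved; certified words are sharper.
[cite: Israel1979, Thm. I.3.4] [cite: KomaTasaki1994, §1] -/
theorem abs_energyDensityTT'_sub_tPrime_le_of_forall_endpoints (t : ℝ) {s₁ s₂ : ℝ} {U : ℝ}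
    (hU : 0 ≤ U) {n : ℝ} (hn0 : 0 ≤ n) (hn2 : n < 2) {A B : ℝ}
    (hA : ∀ (ω₁ : InfVolFermionState 2) (Ls₁ : ℕ → ℕ) (ψ₁ : ∀ L, Fock (Orb (FermionTorus 2 L))),
      Tendsto Ls₁ atTop atTop →
      (∀ j, IsGroundStateInSector (hubbardTorusTT' (Ls₁ j) t s₁ U) (rectN n (Ls₁ j)) 0 (ψ₁ (Ls₁ j))) →
      (∀ j, star (ψ₁ (Ls₁ j)) ⬝ᵥ ψ₁ (Ls₁ j) = 1) → ω₁.IsTorusLimitOf ψ₁ Ls₁ →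
      ω₁.meanEnergy (hubbardTTPrimeFermionInteraction 0 1 0) 1 ≤ A)
    (hB : ∀ (ω₂ : InfVolFermionState 2) (Ls₂ : ℕ → ℕ) (ψ₂ : ∀ L, Fock (Orb (FermionTorus 2 L))),
      Tendsto Ls₂ atTop atTop →
      (∀ j, IsGroundStateInSector (hubbardTorusTT' (Ls₂ j) t s₂ U) (rectN n (Ls₂ j)) 0 (ψ₂ (Ls₂ j))) →
      (∀ j, star (ψ₂ (Ls₂ j)) ⬝ᵥ ψ₂ (Ls₂ j) = 1) → ω₂.IsTorusLimitOf ψ₂ Ls₂ →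
      B ≤ ω₂.meanEnergy (hubbardTTPrimeFermionInteraction 0 1 0) 1)
    {s s' : ℝ} (hs : s ∈ Set.Icc s₁ s₂) (hs' : s' ∈ Set.Icc s₁ s₂) :
    |energyDensityTT' t s U n - energyDensityTT' t s' U n| ≤ max |A| |B| * |s - s'| := by
  rcases le_total s s' with hle | hle
  · obtain ⟨hl, hu⟩ :=
      energyDensityTT'_sub_mem_Icc_of_forall_endpoints t hs.1 hle hs'.2 hU hn0 hn2 hA hB
    rw [abs_sub_comm, abs_sub_comm s s', abs_of_nonneg (sub_nonneg.2 hle)]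
    exact abs_le_max_abs_mul (sub_nonneg.2 hle) hl hu
  · obtain ⟨hl, hu⟩ :=
      energyDensityTT'_sub_mem_Icc_of_forall_endpoints t hs'.1 hle hs.2 hU hn0 hn2 hA hB
    rw [abs_of_nonneg (sub_nonneg.2 hle)]
    exact abs_le_max_abs_mul (sub_nonneg.2 hle) hl hu

/-- **A nonnegative floor word makes `e` non-decreasing to its left**: if every torus-limit ground state
at `(t, s₂, U)`, density `n`, has `0 ≤ K₂`, then `t' ↦ e(t,t',U,n)` is monotone on `(−∞, s₂]`.
[cite: KomaTasaki1994, §1] [cite: Griffiths1966, §II] -/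
theorem monotoneOn_energyDensityTT'_tPrime_of_forall_diagHop_nonneg (t : ℝ) {s₂ : ℝ} {U : ℝ}
    (hU : 0 ≤ U) {n : ℝ} (hn0 : 0 ≤ n) (hn2 : n < 2)
    (hB : ∀ (ω₂ : InfVolFermionState 2) (Ls₂ : ℕ → ℕ) (ψ₂ : ∀ L, Fock (Orb (FermionTorus 2 L))),
      Tendsto Ls₂ atTop atTop →
      (∀ j, IsGroundStateInSector (hubbardTorusTT' (Ls₂ j) t s₂ U) (rectN n (Ls₂ j)) 0 (ψ₂ (Ls₂ j))) →
      (∀ j, star (ψ₂ (Ls₂ j)) ⬝ᵥ ψ₂ (Ls₂ j) = 1) → ω₂.IsTorusLimitOf ψ₂ Ls₂ →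
      0 ≤ ω₂.meanEnergy (hubbardTTPrimeFermionInteraction 0 1 0) 1) :
    MonotoneOn (fun s => energyDensityTT' t s U n) (Set.Iic s₂) := by
  intro s _ s' hs' hss'
  have h := mul_le_energyDensityTT'_sub_of_forall_le_diagHop t hss' hs' hU hn0 hn2 hB
  rw [zero_mul, sub_nonneg] at h
  exact h

/-- **A nonpositive ceiling word makes `e` non-increasing to its right**: if every torus-limit ground
state at `(t, s₁, U)`, density `n`, has `K₂ ≤ 0`, then `t' ↦ e(t,t',U,n)` is antitone on `[s₁, ∞)`.
[cite: KomaTasaki1994, §1] [cite: Griffiths1966, §II] -/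
theorem antitoneOn_energyDensityTT'_tPrime_of_forall_diagHop_nonpos (t : ℝ) {s₁ : ℝ} {U : ℝ}
    (hU : 0 ≤ U) {n : ℝ} (hn0 : 0 ≤ n) (hn2 : n < 2)
    (hA : ∀ (ω₁ : InfVolFermionState 2) (Ls₁ : ℕ → ℕ) (ψ₁ : ∀ L, Fock (Orb (FermionTorus 2 L))),
      Tendsto Ls₁ atTop atTop →
      (∀ j, IsGroundStateInSector (hubbardTorusTT' (Ls₁ j) t s₁ U) (rectN n (Ls₁ j)) 0 (ψ₁ (Ls₁ j))) →
      (∀ j, star (ψ₁ (Ls₁ j)) ⬝ᵥ ψ₁ (Ls₁ j) = 1) → ω₁.IsTorusLimitOf ψ₁ Ls₁ →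
      ω₁.meanEnergy (hubbardTTPrimeFermionInteraction 0 1 0) 1 ≤ 0) :
    AntitoneOn (fun s => energyDensityTT' t s U n) (Set.Ici s₁) := by
  intro s hs s' _ hss'
  have h := energyDensityTT'_sub_le_mul_of_forall_diagHop_le t hs hss' hU hn0 hn2 hA
  rw [zero_mul, sub_nonpos] at h
  exact h

/-- **Word-free Lipschitz law with the kinematic constant, one-sided form**: for `U ≥ 0`, `0 ≤ n < 2`
and all `s, s'`, `e(t,s,U,n) − (16/π²)|s' − s| ≤ e(t,s',U,n)` (superadditivity
`e(t,s',U) ≥ e(t,s,U) + e(0,s'−s,0)` and the diagonal-band floor `e(0,τ,0,n) ≥ −16|τ|/π²`).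
[cite: Israel1979, Thm. I.3.4] [cite: LiebLoss1993, §8, Theorem 8.2] -/
theorem energyDensityTT'_sub_sixteen_div_pi_sq_mul_le (t : ℝ) {U : ℝ} (hU : 0 ≤ U) {n : ℝ}
    (hn0 : 0 ≤ n) (hn2 : n < 2) (s s' : ℝ) :
    energyDensityTT' t s U n - 16 / Real.pi ^ 2 * |s' - s| ≤ energyDensityTT' t s' U n := by
  have h1 := energyDensityTT'_add_ge t 0 s (s' - s) hU le_rfl hn0 hn2
  have h2 := neg_sixteen_mul_abs_div_pi_sq_le_energyDensityTT'_diag (s' - s) le_rfl hn0 hn2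
  rw [add_zero, add_sub_cancel, add_zero] at h1
  have e1 : -(16 * |s' - s|) / Real.pi ^ 2 = -(16 / Real.pi ^ 2 * |s' - s|) := by ring
  rw [e1] at h2
  linarith

/-- **`|e(t,s,U,n) − e(t,s',U,n)| ≤ (16/π²)|s − s'|`** (`U ≥ 0`, `0 ≤ n < 2`): the energy density is
Lipschitz in `t'` with the half-filled diagonal-band constant — sharper than the tree's `4n`
(`abs_energyDensityTT'_sub_tPrime_le`) for `n > 4/π²`. [cite: Israel1979, Thm. I.3.4] -/
theorem abs_energyDensityTT'_sub_tPrime_le_sixteen_div_pi_sq (t : ℝ) {U : ℝ} (hU : 0 ≤ U) {n : ℝ}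
    (hn0 : 0 ≤ n) (hn2 : n < 2) (s s' : ℝ) :
    |energyDensityTT' t s U n - energyDensityTT' t s' U n| ≤ 16 / Real.pi ^ 2 * |s - s'| := by
  have h1 := energyDensityTT'_sub_sixteen_div_pi_sq_mul_le t hU hn0 hn2 s s'
  have h2 := energyDensityTT'_sub_sixteen_div_pi_sq_mul_le t hU hn0 hn2 s' s
  rw [abs_sub_comm s' s] at h1
  rw [abs_le]
  constructor <;> linarith

/-- From a certified LOWER bound at one `t'` to every `t'` with the kinematic constant:
`L ≤ e(t,s,U,n)` gives `L − (16/π²)|s' − s| ≤ e(t,s',U,n)`. [cite: Israel1979, Thm. I.3.4] -/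
theorem energyDensityTT'_ge_of_lowerBound_tPrime_kinematic (t : ℝ) {U : ℝ} (hU : 0 ≤ U) {n : ℝ}
    (hn0 : 0 ≤ n) (hn2 : n < 2) {s s' L : ℝ} (hL : L ≤ energyDensityTT' t s U n) :
    L - 16 / Real.pi ^ 2 * |s' - s| ≤ energyDensityTT' t s' U n :=
  le_trans (by linarith) (energyDensityTT'_sub_sixteen_div_pi_sq_mul_le t hU hn0 hn2 s s')

/-- From a certified UPPER bound at one `t'` to every `t'` with the kinematic constant:
`e(t,s,U,n) ≤ R` gives `e(t,s',U,n) ≤ R + (16/π²)|s' − s|`. [cite: Israel1979, Thm. I.3.4] -/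
theorem energyDensityTT'_le_of_upperBound_tPrime_kinematic (t : ℝ) {U : ℝ} (hU : 0 ≤ U) {n : ℝ}
    (hn0 : 0 ≤ n) (hn2 : n < 2) {s s' R : ℝ} (hR : energyDensityTT' t s U n ≤ R) :
    energyDensityTT' t s' U n ≤ R + 16 / Real.pi ^ 2 * |s' - s| := by
  have h := energyDensityTT'_sub_sixteen_div_pi_sq_mul_le t hU hn0 hn2 s' s
  rw [abs_sub_comm s s'] at h
  linarith

/-- **The box FLOOR is the `min` of the endpoint floors** (concavity in `t'`, closed-box form): for
`U ≥ 0`, `0 ≤ n < 2`, certified lower bounds `lo₁ ≤ e(t,s₁,U,n)`, `lo₂ ≤ e(t,s₂,U,n)` and every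
`s ∈ [s₁, s₂]`: `min lo₁ lo₂ ≤ e(t,s,U,n)` (the tree's open-interval chord is
`energyDensityTT'_tPrime_chord_le`). [cite: Ruelle1969, §3.4] -/
theorem energyDensityTT'_ge_min_of_mem_Icc_tPrime (t : ℝ) {U : ℝ} (hU : 0 ≤ U) {n : ℝ} (hn0 : 0 ≤ n)
    (hn2 : n < 2) {s₁ s₂ s lo₁ lo₂ : ℝ} (hs : s ∈ Set.Icc s₁ s₂)
    (h₁ : lo₁ ≤ energyDensityTT' t s₁ U n) (h₂ : lo₂ ≤ energyDensityTT' t s₂ U n) :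
    min lo₁ lo₂ ≤ energyDensityTT' t s U n := by
  have hseg : s ∈ segment ℝ s₁ s₂ := by
    rw [segment_eq_Icc (hs.1.trans hs.2)]
    exact hs
  have hc := (concaveOn_energyDensityTT'_tPrime t hU hn0 hn2).ge_on_segment (Set.mem_univ s₁)
    (Set.mem_univ s₂) hseg
  exact (min_le_min h₁ h₂).trans hc

end ThermodynamicLimit

/-! ### §6 The Lipschitz constant of a cap-class certified word along `t'` is `κ_cap · (A − B)` -/

namespace InfVolFermionState

/-- **Linear degradation of a cap-class word across the box.** Same box data as
`forall_groundState_tPrime_box_of_forall_cap` (ceiling word `A` at `s₁`, floor word `B` at `s₂`,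
anchor `s₀ ∈ [s₁, s₂]` with cap `e(t,s₀,U,n) ≤ u₀`). Suppose a real-valued word `f` is certified at the
anchor WITH ITS CAP SLACK EXPLICIT: for every torus limit `ω` of unit `rectN n`-vectors,
`c + κ·(u₀ − e_{Φ(t,s₀,U)}(ω)) ≤ f ω` with a cap multiplier `κ ≥ 0` (the shape of the window identity read
in an abstract state, `κ (u − e^{tt'}(ω))` kept explicit). Then for every torus-limit ground state `ω`
at any `t' = s ∈ [s₁, s₂]`: `c − κ·|s − s₀|·(A − B) ≤ f ω` — the certified word degrades linearly in `t'`
with Lipschitz constant `κ (A − B)`. [cite: WangEtAl2024, §III] [cite: KomaTasaki1994, §1] -/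
theorem IsTorusLimitOf.sub_mul_le_word_of_forall_capSlack (t : ℝ) {s₁ s₂ s₀ : ℝ}
    (hs₀ : s₀ ∈ Set.Icc s₁ s₂) {U : ℝ} (hU : 0 ≤ U) {n : ℝ} (hn0 : 0 ≤ n) (hn2 : n < 2)
    {u₀ A B κ c : ℝ} (hκ : 0 ≤ κ) (hu₀ : energyDensityTT' t s₀ U n ≤ u₀)
    (hA : ∀ (ω₁ : InfVolFermionState 2) (Ls₁ : ℕ → ℕ) (ψ₁ : ∀ L, Fock (Orb (FermionTorus 2 L))),
      Tendsto Ls₁ atTop atTop →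
      (∀ j, IsGroundStateInSector (hubbardTorusTT' (Ls₁ j) t s₁ U) (rectN n (Ls₁ j)) 0 (ψ₁ (Ls₁ j))) →
      (∀ j, star (ψ₁ (Ls₁ j)) ⬝ᵥ ψ₁ (Ls₁ j) = 1) → ω₁.IsTorusLimitOf ψ₁ Ls₁ →
      ω₁.meanEnergy (hubbardTTPrimeFermionInteraction 0 1 0) 1 ≤ A)
    (hB : ∀ (ω₂ : InfVolFermionState 2) (Ls₂ : ℕ → ℕ) (ψ₂ : ∀ L, Fock (Orb (FermionTorus 2 L))),
      Tendsto Ls₂ atTop atTop →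
      (∀ j, IsGroundStateInSector (hubbardTorusTT' (Ls₂ j) t s₂ U) (rectN n (Ls₂ j)) 0 (ψ₂ (Ls₂ j))) →
      (∀ j, star (ψ₂ (Ls₂ j)) ⬝ᵥ ψ₂ (Ls₂ j) = 1) → ω₂.IsTorusLimitOf ψ₂ Ls₂ →
      B ≤ ω₂.meanEnergy (hubbardTTPrimeFermionInteraction 0 1 0) 1)
    {f : InfVolFermionState 2 → ℝ}
    (hf : ∀ (ω : InfVolFermionState 2) (Ls : ℕ → ℕ) (ψ : ∀ L, Fock (Orb (FermionTorus 2 L))),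
      Tendsto Ls atTop atTop → (∀ j, IsNParticle (rectN n (Ls j)) (ψ (Ls j))) →
      (∀ j, star (ψ (Ls j)) ⬝ᵥ ψ (Ls j) = 1) → ω.IsTorusLimitOf ψ Ls →
      c + κ * (u₀ - ω.meanEnergy (hubbardTTPrimeFermionInteraction t s₀ U) 1) ≤ f ω)
    {s : ℝ} (hs : s ∈ Set.Icc s₁ s₂)
    {ω : InfVolFermionState 2} {ψ : ∀ L, Fock (Orb (FermionTorus 2 L))} {Ls : ℕ → ℕ}
    (h : ω.IsTorusLimitOf ψ Ls) (hLs : Tendsto Ls atTop atTop)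
    (hψ : ∀ j, IsGroundStateInSector (hubbardTorusTT' (Ls j) t s U) (rectN n (Ls j)) 0 (ψ (Ls j)))
    (h1 : ∀ j, star (ψ (Ls j)) ⬝ᵥ ψ (Ls j) = 1) :
    c - κ * (|s - s₀| * (A - B)) ≤ f ω := by
  have hN : ∀ j, IsNParticle (rectN n (Ls j)) (ψ (Ls j)) := fun j =>
    ((mem_szSector_iff _ _ _).1 (hψ j).1).1
  have hfω := hf ω Ls ψ hLs hN h1 h
  obtain ⟨-, hcap⟩ := h.meanEnergy_anchor_mem_Icc_of_forall_endpoints t hs₀ hs hU hn0 hn2 hA hB hLs hψ h1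
  have hslack : -(|s - s₀| * (A - B)) ≤
      u₀ - ω.meanEnergy (hubbardTTPrimeFermionInteraction t s₀ U) 1 := by linarith
  have hκs := mul_le_mul_of_nonneg_left hslack hκ
  linarith

/-- **Word-free form**: with the kinematic inflation, `c − κ·(32/π²)·|s − s₀| ≤ f ω` for every
torus-limit ground state `ω` at any `t' = s` (anchor `s₀` anywhere, no endpoint words).
[cite: WangEtAl2024, §III] [cite: LiebLoss1993, §8, Theorem 8.2] -/
theorem IsTorusLimitOf.sub_mul_le_word_of_forall_capSlack_kinematic (t s₀ : ℝ) {U : ℝ} (hU : 0 ≤ U)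
    {n : ℝ} (hn0 : 0 ≤ n) (hn2 : n < 2) {u₀ κ c : ℝ} (hκ : 0 ≤ κ)
    (hu₀ : energyDensityTT' t s₀ U n ≤ u₀)
    {f : InfVolFermionState 2 → ℝ}
    (hf : ∀ (ω : InfVolFermionState 2) (Ls : ℕ → ℕ) (ψ : ∀ L, Fock (Orb (FermionTorus 2 L))),
      Tendsto Ls atTop atTop → (∀ j, IsNParticle (rectN n (Ls j)) (ψ (Ls j))) →
      (∀ j, star (ψ (Ls j)) ⬝ᵥ ψ (Ls j) = 1) → ω.IsTorusLimitOf ψ Ls →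
      c + κ * (u₀ - ω.meanEnergy (hubbardTTPrimeFermionInteraction t s₀ U) 1) ≤ f ω)
    (s : ℝ) {ω : InfVolFermionState 2} {ψ : ∀ L, Fock (Orb (FermionTorus 2 L))} {Ls : ℕ → ℕ}
    (h : ω.IsTorusLimitOf ψ Ls) (hLs : Tendsto Ls atTop atTop)
    (hψ : ∀ j, IsGroundStateInSector (hubbardTorusTT' (Ls j) t s U) (rectN n (Ls j)) 0 (ψ (Ls j)))
    (h1 : ∀ j, star (ψ (Ls j)) ⬝ᵥ ψ (Ls j) = 1) :
    c - κ * (32 / Real.pi ^ 2 * |s - s₀|) ≤ f ω := by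
  have hN : ∀ j, IsNParticle (rectN n (Ls j)) (ψ (Ls j)) := fun j =>
    ((mem_szSector_iff _ _ _).1 (hψ j).1).1
  have hfω := hf ω Ls ψ hLs hN h1 h
  obtain ⟨-, hcap⟩ := h.meanEnergy_anchor_mem_Icc_kinematic t s₀ s hU hn0 hn2 hLs hψ h1
  have hslack : -(32 / Real.pi ^ 2 * |s - s₀|) ≤
      u₀ - ω.meanEnergy (hubbardTTPrimeFermionInteraction t s₀ U) 1 := by linarith
  have hκs := mul_le_mul_of_nonneg_left hslack hκ
  linarith

end InfVolFermionState

/-! ### §7 Half filling: evenness in `t'` makes the box rules loss-free and the sign word free -/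

namespace ThermodynamicLimit

open InfVolFermionState

/-- **At half filling `t' ↦ e(t,t',U,1)` is non-decreasing on `(−∞, 0]`**: `e(t,·,U,1)` is concave
(`concaveOn_energyDensityTT'_tPrime`) and even (`energyDensityTT'_particleHole_one`), so for
`s ≤ s' ≤ 0` the point `s'` lies between `s` and `−s` where `e` takes equal values.
[cite: LiebWuPhysicaA2003, §1 eq. (3)] [cite: Ruelle1969, §3.3] -/
theorem monotoneOn_energyDensityTT'_tPrime_one (t : ℝ) {U : ℝ} (hU : 0 ≤ U) :
    MonotoneOn (fun s => energyDensityTT' t s U 1) (Set.Iic (0 : ℝ)) := by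
  intro s _ s' hs' hss'
  rcases hss'.eq_or_lt with heq | hlt
  · subst heq
    exact le_rfl
  · have hs'0 : s' ≤ 0 := hs'
    have hseg : s' ∈ segment ℝ s (-s) := by
      rw [segment_eq_Icc (by linarith : s ≤ -s)]
      exact ⟨hlt.le, by linarith⟩
    have hc := (concaveOn_energyDensityTT'_tPrime t hU (n := 1) zero_le_one one_lt_two).ge_on_segment
      (Set.mem_univ s) (Set.mem_univ (-s)) hseg
    rw [energyDensityTT'_particleHole_one t s hU, min_self] at hc
    exact hc

/-- **At half filling `t' ↦ e(t,t',U,1)` is non-increasing on `[0, ∞)`** (mirror image).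
[cite: LiebWuPhysicaA2003, §1 eq. (3)] [cite: Ruelle1969, §3.3] -/
theorem antitoneOn_energyDensityTT'_tPrime_one (t : ℝ) {U : ℝ} (hU : 0 ≤ U) :
    AntitoneOn (fun s => energyDensityTT' t s U 1) (Set.Ici (0 : ℝ)) := by
  intro s hs s' _ hss'
  rcases hss'.eq_or_lt with heq | hlt
  · subst heq
    exact le_rfl
  · have hs0 : 0 ≤ s := hs
    have hseg : s ∈ segment ℝ (-s') s' := by
      rw [segment_eq_Icc (by linarith : -s' ≤ s')]
      exact ⟨by linarith, hlt.le⟩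
    have hc := (concaveOn_energyDensityTT'_tPrime t hU (n := 1) zero_le_one one_lt_two).ge_on_segment
      (Set.mem_univ (-s')) (Set.mem_univ s') hseg
    rw [energyDensityTT'_particleHole_one t s' hU, min_self] at hc
    exact hc

/-- **Loss-free box word at half filling, hole-like side**: for a box `[s₁, s₂]` with `s₂ ≤ 0`, a floor
`lo₁ ≤ e(t,s₁,U,1)` at the LEFT endpoint and a cap `e(t,s₂,U,1) ≤ u₂` at the RIGHT endpoint bound `e`
on the whole box: `lo₁ ≤ e(t,s,U,1) ≤ u₂` for every `s ∈ [s₁, s₂]`.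
[cite: LiebWuPhysicaA2003, §1 eq. (3)] [cite: Ruelle1969, §3.3] -/
theorem energyDensityTT'_one_mem_Icc_of_box_nonpos (t : ℝ) {U : ℝ} (hU : 0 ≤ U)
    {s₁ s₂ s lo₁ u₂ : ℝ} (hs₂ : s₂ ≤ 0) (hs : s ∈ Set.Icc s₁ s₂)
    (hlo : lo₁ ≤ energyDensityTT' t s₁ U 1) (hu : energyDensityTT' t s₂ U 1 ≤ u₂) :
    energyDensityTT' t s U 1 ∈ Set.Icc lo₁ u₂ := by
  have hm := monotoneOn_energyDensityTT'_tPrime_one t hU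
  have hs0 : s ≤ 0 := hs.2.trans hs₂
  have h1 : energyDensityTT' t s₁ U 1 ≤ energyDensityTT' t s U 1 :=
    hm (show s₁ ∈ Set.Iic (0 : ℝ) from hs.1.trans hs0) (show s ∈ Set.Iic (0 : ℝ) from hs0) hs.1
  have h2 : energyDensityTT' t s U 1 ≤ energyDensityTT' t s₂ U 1 :=
    hm (show s ∈ Set.Iic (0 : ℝ) from hs0) (show s₂ ∈ Set.Iic (0 : ℝ) from hs₂) hs.2
  exact ⟨hlo.trans h1, h2.trans hu⟩

/-- **Loss-free box word at half filling, electron-like side**: for a box `[s₁, s₂]` with `0 ≤ s₁`, a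
floor `lo₂ ≤ e(t,s₂,U,1)` at the RIGHT endpoint and a cap `e(t,s₁,U,1) ≤ u₁` at the LEFT endpoint give
`lo₂ ≤ e(t,s,U,1) ≤ u₁` on the whole box. [cite: LiebWuPhysicaA2003, §1 eq. (3)] [cite: Ruelle1969, §3.3] -/
theorem energyDensityTT'_one_mem_Icc_of_box_nonneg (t : ℝ) {U : ℝ} (hU : 0 ≤ U)
    {s₁ s₂ s lo₂ u₁ : ℝ} (hs₁ : 0 ≤ s₁) (hs : s ∈ Set.Icc s₁ s₂)
    (hlo : lo₂ ≤ energyDensityTT' t s₂ U 1) (hu : energyDensityTT' t s₁ U 1 ≤ u₁) :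
    energyDensityTT' t s U 1 ∈ Set.Icc lo₂ u₁ := by
  have hm := antitoneOn_energyDensityTT'_tPrime_one t hU
  have hs0 : 0 ≤ s := hs₁.trans hs.1
  have h1 : energyDensityTT' t s₂ U 1 ≤ energyDensityTT' t s U 1 :=
    hm (show s ∈ Set.Ici (0 : ℝ) from hs0) (show s₂ ∈ Set.Ici (0 : ℝ) from hs0.trans hs.2) hs.2
  have h2 : energyDensityTT' t s U 1 ≤ energyDensityTT' t s₁ U 1 :=
    hm (show s₁ ∈ Set.Ici (0 : ℝ) from hs₁) (show s ∈ Set.Ici (0 : ℝ) from hs0) hs.1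
  exact ⟨hlo.trans h1, h2.trans hu⟩

end ThermodynamicLimit

namespace InfVolFermionState

/-- **The free sign word at half filling, `t' < 0`**: every torus-limit ground state `ω` at
`(t, s, U)` with `s < 0`, density `1` (`U ≥ 0`) has `0 ≤ K₂(ω)` — the tangent inequality from `s` to
`−s` and evenness `e(t,−s,U,1) = e(t,s,U,1)` give `0 ≤ (−2s)·K₂(ω)`. Hence the floor word `B = 0` holds
at every `s₂ < 0` for free (§1, §3, §5 apply with it). [cite: KomaTasaki1994, §1] [cite: LiebWuPhysicaA2003, §1 eq. (3)] -/
theorem IsTorusLimitOf.meanEnergy_diagHop_nonneg_of_one_of_neg (t : ℝ) {s : ℝ} (hs : s < 0)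
    {U : ℝ} (hU : 0 ≤ U)
    {ω : InfVolFermionState 2} {ψ : ∀ L, Fock (Orb (FermionTorus 2 L))} {Ls : ℕ → ℕ}
    (h : ω.IsTorusLimitOf ψ Ls) (hLs : Tendsto Ls atTop atTop)
    (hψ : ∀ j, IsGroundStateInSector (hubbardTorusTT' (Ls j) t s U) (rectN 1 (Ls j)) 0 (ψ (Ls j)))
    (h1 : ∀ j, star (ψ (Ls j)) ⬝ᵥ ψ (Ls j) = 1) :
    0 ≤ ω.meanEnergy (hubbardTTPrimeFermionInteraction 0 1 0) 1 := by
  have htan := h.energyDensityTT'_sub_le_mul_meanEnergy_diag t s hU (n := 1) zero_le_one one_lt_two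
    hLs hψ h1 (-s)
  rw [energyDensityTT'_particleHole_one t s hU, sub_self] at htan
  have h2 : 0 < -s - s := by linarith
  by_contra hK
  rw [not_le] at hK
  have := mul_neg_of_pos_of_neg h2 hK
  linarith

/-- **The free sign word at half filling, `t' > 0`**: every torus-limit ground state at `(t, s, U)` with
`0 < s`, density `1`, has `K₂(ω) ≤ 0` (ceiling word `A = 0` at every `s₁ > 0`).
[cite: KomaTasaki1994, §1] [cite: LiebWuPhysicaA2003, §1 eq. (3)] -/
theorem IsTorusLimitOf.meanEnergy_diagHop_nonpos_of_one_of_pos (t : ℝ) {s : ℝ} (hs : 0 < s)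
    {U : ℝ} (hU : 0 ≤ U)
    {ω : InfVolFermionState 2} {ψ : ∀ L, Fock (Orb (FermionTorus 2 L))} {Ls : ℕ → ℕ}
    (h : ω.IsTorusLimitOf ψ Ls) (hLs : Tendsto Ls atTop atTop)
    (hψ : ∀ j, IsGroundStateInSector (hubbardTorusTT' (Ls j) t s U) (rectN 1 (Ls j)) 0 (ψ (Ls j)))
    (h1 : ∀ j, star (ψ (Ls j)) ⬝ᵥ ψ (Ls j) = 1) :
    ω.meanEnergy (hubbardTTPrimeFermionInteraction 0 1 0) 1 ≤ 0 := by
  have htan := h.energyDensityTT'_sub_le_mul_meanEnergy_diag t s hU (n := 1) zero_le_one one_lt_two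
    hLs hψ h1 (-s)
  rw [energyDensityTT'_particleHole_one t s hU, sub_self] at htan
  have h2 : -s - s < 0 := by linarith
  by_contra hK
  rw [not_le] at hK
  have := mul_neg_of_neg_of_pos h2 hK
  linarith

/-- **Cap transport at half filling, right of the anchor, needs only the anchor's ceiling word**: for
`s₀ ≤ s < 0`, a cap `e(t,s₀,U,1) ≤ u₀` and a ceiling word `A₀` at the anchor, every torus-limit
ground state `ω` at `(t, s, U)`, density `1`, has `e_{Φ(t,s₀,U)}(ω) ≤ u₀ + (s − s₀)·A₀` (the floor word
is the free `K₂(ω) ≥ 0`). [cite: KomaTasaki1994, §1] [cite: WangEtAl2024, §III] -/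
theorem IsTorusLimitOf.meanEnergy_anchor_le_of_one_of_neg (t : ℝ) {s₀ s : ℝ} (h0s : s₀ ≤ s)
    (hs : s < 0) {U : ℝ} (hU : 0 ≤ U) {u₀ A₀ : ℝ} (hu₀ : energyDensityTT' t s₀ U 1 ≤ u₀)
    (hA₀ : ∀ (ω₀ : InfVolFermionState 2) (Ls₀ : ℕ → ℕ) (ψ₀ : ∀ L, Fock (Orb (FermionTorus 2 L))),
      Tendsto Ls₀ atTop atTop →
      (∀ j, IsGroundStateInSector (hubbardTorusTT' (Ls₀ j) t s₀ U) (rectN 1 (Ls₀ j)) 0 (ψ₀ (Ls₀ j))) →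
      (∀ j, star (ψ₀ (Ls₀ j)) ⬝ᵥ ψ₀ (Ls₀ j) = 1) → ω₀.IsTorusLimitOf ψ₀ Ls₀ →
      ω₀.meanEnergy (hubbardTTPrimeFermionInteraction 0 1 0) 1 ≤ A₀)
    {ω : InfVolFermionState 2} {ψ : ∀ L, Fock (Orb (FermionTorus 2 L))} {Ls : ℕ → ℕ}
    (h : ω.IsTorusLimitOf ψ Ls) (hLs : Tendsto Ls atTop atTop)
    (hψ : ∀ j, IsGroundStateInSector (hubbardTorusTT' (Ls j) t s U) (rectN 1 (Ls j)) 0 (ψ (Ls j)))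
    (h1 : ∀ j, star (ψ (Ls j)) ⬝ᵥ ψ (Ls j) = 1) :
    ω.meanEnergy (hubbardTTPrimeFermionInteraction t s₀ U) 1 ≤ u₀ + (s - s₀) * A₀ := by
  have hB : ∀ (ω₂ : InfVolFermionState 2) (Ls₂ : ℕ → ℕ) (ψ₂ : ∀ L, Fock (Orb (FermionTorus 2 L))),
      Tendsto Ls₂ atTop atTop →
      (∀ j, IsGroundStateInSector (hubbardTorusTT' (Ls₂ j) t s U) (rectN 1 (Ls₂ j)) 0 (ψ₂ (Ls₂ j))) →
      (∀ j, star (ψ₂ (Ls₂ j)) ⬝ᵥ ψ₂ (Ls₂ j) = 1) → ω₂.IsTorusLimitOf ψ₂ Ls₂ →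
      0 ≤ ω₂.meanEnergy (hubbardTTPrimeFermionInteraction 0 1 0) 1 :=
    fun ω₂ Ls₂ ψ₂ hLs₂ hψ₂ h1₂ hω₂ =>
      hω₂.meanEnergy_diagHop_nonneg_of_one_of_neg t hs hU hLs₂ hψ₂ h1₂
  have hmain := h.meanEnergy_anchor_le_of_forall_right t h0s le_rfl hU (n := 1) zero_le_one one_lt_two
    hu₀ hA₀ hB hLs hψ h1
  rw [sub_zero] at hmain
  exact hmain

end InfVolFermionState

end Literature.MathematicalPhysics.QuantumLattice

end
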